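import Mathlib
import Summits.PneNP.PneNP.Theorems.ClusUniversalCertificateCoordDefs

/-!
# Route ClusUniversalCertificate, crux `UniversalCertAll` — path `coord`: the ZERO-FREE BASE

Support file for `stmt-PneNP-19683` (cell pnp-ideate, route `ClusUniversalCertificate`, rung F-N1; path `coord` of pnp-ideate-p1,
skeleton v11 sha16 e5cba65d; objects of record `ClusUniversalCertificateCoordDefs.lean` p516754, namespace `…Theorems.ClusCoord`).

**Theorem (`ucMix_of_zeroFree`).**  If no point of `Y ⊆ 𝔽₂^M` has a vanishing NONEMPTY block, the mixed certificate
`UCMix M n blk Y` holds — trivially, because its left-hand side is then nonpositive up to the empty blocks: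

* FLAT LEMMA (`finrank_direction_add_card_le`): if an affine flat `A ∋ y` avoids `{z : z|_{B_j} = 0}` for every block `j` of a set
  `J` of blocks, then `finrank A.direction + |J| ≤ M`.  Proof: for each `j ∈ J` the block-`j` projection of `A` is a flat not
  containing `0`, so (`Submodule.exists_dual_map_eq_bot_of_notMem`) there is a linear functional `f_j` with `f_j ∘ π_j ≡ 1` on `A`,
  i.e. vanishing on `π_j(A.direction)` and `= 1` at `π_j y`; the map `Ψ = (f_j ∘ π_j)_{j ∈ J}` kills `A.direction` and sends the
  block-restricted copies `π_j y` of `y` to the standard basis, so it is onto `𝔽₂^J`; rank–nullity.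
* Hence every point of a set `Y` with no vanishing nonempty block has certificate codimension `acodim ≥ #nonempty blocks`
  (`card_le_acodim`), so `Σ_y ((M − acodim y) − Σ_j (bsize j − 1)) ≤ e·|Y|` with `e` the number of EMPTY blocks, while each empty
  block contributes `2^0·Z_j(Y) = |Y|` to the right-hand side.

USE (p1's peel induction `ucMixDim_all_peel3`): an extra BASE — the conjecture `stub_peelZeroRare3` is then needed only for zero-rare sets
with SOME nonempty block `j` having `Z_j(Y) ≥ 1`; in particular the tight nowhere-zero family `N^n` and all zero-free sets leave its scope.
FRONTIER rung F-N1 (a combinatorial certificate about affine flats in `𝔽₂^M`); the conjecture and the crux are OPEN; nothing here bears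
on P vs NP.
-/

set_option linter.dupNamespace false -- `Summit.PneNP.PneNP.…`: summit = sub-problem name (D-0017 single-conjunct layout)

namespace Summit.PneNP.PneNP.Theorems.ClusCoordZeroFree

open Finset
open Summit.PneNP.PneNP.Theorems.ClusCoord (acodim bsize zcount UCMix)

variable {M n : ℕ}

/-! ## The block projections -/

/-- The linear projection keeping block `j` and zeroing every other coordinate. -/
def blockProj (blk : Fin M → Fin n) (j : Fin n) : (Fin M → ZMod 2) →ₗ[ZMod 2] (Fin M → ZMod 2) where
  toFun v := fun i => if blk i = j then v i else 0
  map_add' u v := by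
    funext i
    simp only [Pi.add_apply]
    split_ifs <;> simp
  map_smul' c v := by
    funext i
    simp only [Pi.smul_apply, smul_eq_mul, RingHom.id_apply]
    split_ifs <;> simp

/-- The block projection, coordinatewise. -/
theorem blockProj_apply (blk : Fin M → Fin n) (j : Fin n) (v : Fin M → ZMod 2) (i : Fin M) :
    blockProj blk j v i = if blk i = j then v i else 0 := rfl

/-- Block `j` of `v` vanishes iff its block-`j` projection is `0`. -/
theorem blockProj_eq_zero_iff (blk : Fin M → Fin n) (j : Fin n) (v : Fin M → ZMod 2) :
    blockProj blk j v = 0 ↔ ∀ i, blk i = j → v i = 0 := by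
  constructor
  · intro h i hi
    have := congrFun h i
    rw [blockProj_apply, if_pos hi] at this
    exact this
  · intro h
    funext i
    rw [blockProj_apply]
    split_ifs with hi
    · exact h i hi
    · rfl

/-- The projections are idempotent. -/
theorem blockProj_blockProj_self (blk : Fin M → Fin n) (j : Fin n) (v : Fin M → ZMod 2) :
    blockProj blk j (blockProj blk j v) = blockProj blk j v := by
  funext i
  simp only [blockProj_apply]
  split_ifs <;> rfl

/-- Distinct blocks have orthogonal projections. -/
theorem blockProj_blockProj_of_ne (blk : Fin M → Fin n) {j l : Fin n} (h : l ≠ j) (v : Fin M → ZMod 2) :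
    blockProj blk l (blockProj blk j v) = 0 := by
  funext i
  simp only [blockProj_apply, Pi.zero_apply]
  split_ifs with h1 h2
  · exact absurd (h1.symm.trans h2) h
  · rfl
  · rfl

/-! ## One functional per zero-avoiding block -/

/-- If the flat `A ∋ y` has no point whose block `j` vanishes, some linear functional `f` satisfies `f ∘ π_j ≡ 1` on `A`:
it kills `π_j(A.direction)` and takes the value `1` at `π_j y`. -/
theorem exists_dual_blockProj (blk : Fin M → Fin n) (A : AffineSubspace (ZMod 2) (Fin M → ZMod 2)) (y : Fin M → ZMod 2)
    (hy : y ∈ A) (j : Fin n) (hA : ∀ z ∈ A, ¬ (∀ i, blk i = j → z i = 0)) :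
    ∃ f : Module.Dual (ZMod 2) (Fin M → ZMod 2),
      (∀ d ∈ A.direction, f (blockProj blk j d) = 0) ∧ f (blockProj blk j y) = 1 := by
  set p : Submodule (ZMod 2) (Fin M → ZMod 2) := A.direction.map (blockProj blk j) with hp
  have hx : blockProj blk j y ∉ p := by
    intro h
    rw [hp, Submodule.mem_map] at h
    obtain ⟨d, hd, hdx⟩ := h
    have hz : (-d) +ᵥ y ∈ A := AffineSubspace.vadd_mem_of_mem_direction (A.direction.neg_mem hd) hy
    apply hA _ hz
    rw [← blockProj_eq_zero_iff, vadd_eq_add, map_add, map_neg, hdx, neg_add_cancel]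
  obtain ⟨f, hf1, hf2⟩ := Submodule.exists_dual_map_eq_bot_of_notMem hx inferInstance
  refine ⟨f, fun d hd => ?_, ?_⟩
  · have hmem : f (blockProj blk j d) ∈ p.map f :=
      Submodule.mem_map_of_mem (Submodule.mem_map_of_mem hd)
    rw [hf2, Submodule.mem_bot] at hmem
    exact hmem
  · have h01 : ∀ a : ZMod 2, a ≠ 0 → a = 1 := by decide
    exact h01 _ hf1

/-! ## The flat lemma -/

/-- **Flat lemma.**  A flat through `y` avoiding the zero set of every block in `J` has `finrank (direction) + |J| ≤ M`. -/
theorem finrank_direction_add_card_le (blk : Fin M → Fin n) (A : AffineSubspace (ZMod 2) (Fin M → ZMod 2))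
    (y : Fin M → ZMod 2) (hy : y ∈ A) (J : Finset (Fin n))
    (hJ : ∀ j ∈ J, ∀ z ∈ A, ¬ (∀ i, blk i = j → z i = 0)) :
    Module.finrank (ZMod 2) A.direction + J.card ≤ M := by
  have hf : ∀ j : J, ∃ f : Module.Dual (ZMod 2) (Fin M → ZMod 2),
      (∀ d ∈ A.direction, f (blockProj blk j d) = 0) ∧ f (blockProj blk j y) = 1 :=
    fun j => exists_dual_blockProj blk A y hy j (hJ j j.2)
  choose f hf0 hf1 using hf
  -- the map `Ψ = (f_j ∘ π_j)_{j ∈ J}`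
  let Ψ : (Fin M → ZMod 2) →ₗ[ZMod 2] (J → ZMod 2) := LinearMap.pi fun j : J => (f j).comp (blockProj blk j)
  have hΨ : ∀ v : Fin M → ZMod 2, ∀ j : J, Ψ v j = f j (blockProj blk j v) := fun v j => rfl
  -- it kills the direction
  have hker : A.direction ≤ LinearMap.ker Ψ := by
    intro d hd
    rw [LinearMap.mem_ker]
    funext j
    rw [hΨ, hf0 j d hd]
    rfl
  -- it is onto: the block-restricted copies of `y` go to the standard basis
  have hsingle : ∀ j₀ : J, Ψ (blockProj blk j₀ y) = Pi.single j₀ 1 := by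
    intro j₀
    funext j
    rw [hΨ]
    by_cases h : j = j₀
    · subst h
      rw [blockProj_blockProj_self, hf1, Pi.single_eq_same]
    · have hne : (j : Fin n) ≠ (j₀ : Fin n) := fun h' => h (Subtype.ext h')
      rw [blockProj_blockProj_of_ne blk hne, map_zero, Pi.single_eq_of_ne h]
  have hrange : LinearMap.range Ψ = ⊤ := by
    rw [eq_top_iff]
    intro w _
    rw [pi_eq_sum_univ w]
    refine Submodule.sum_mem _ fun j _ => Submodule.smul_mem _ _ ?_
    have : (fun j' : J => if j = j' then (1 : ZMod 2) else 0) = Pi.single j 1 := by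
      funext j'
      by_cases h : j = j'
      · subst h; simp
      · rw [if_neg h, Pi.single_eq_of_ne (Ne.symm h)]
    rw [this, ← hsingle j]
    exact LinearMap.mem_range_self Ψ _
  -- rank–nullity
  have hrn := LinearMap.finrank_range_add_finrank_ker Ψ
  rw [hrange, finrank_top, Module.finrank_fintype_fun_eq_card, Module.finrank_fintype_fun_eq_card,
    Fintype.card_coe, Fintype.card_fin] at hrn
  have hD : Module.finrank (ZMod 2) A.direction ≤ Module.finrank (ZMod 2) (LinearMap.ker Ψ) :=
    Submodule.finrank_mono hker
  omega

/-! ## The certificate codimension of a zero-free set -/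

/-- In a set with no vanishing block from `J`, every point has certificate codimension at least `|J|`. -/
theorem card_le_acodim (blk : Fin M → Fin n) (Y : Finset (Fin M → ZMod 2)) (J : Finset (Fin n))
    (hJ : ∀ j ∈ J, ∀ z ∈ Y, ¬ (∀ i, blk i = j → z i = 0)) (y : Fin M → ZMod 2) (hy : y ∈ Y) :
    J.card ≤ acodim M Y y := by
  unfold acodim
  apply le_csInf
  · -- the singleton flat through `y` witnesses nonemptiness
    refine ⟨M, AffineSubspace.mk' y ⊥, AffineSubspace.self_mem_mk' _ _, ?_, by simp⟩
    intro z hz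
    rw [AffineSubspace.mem_mk'] at hz
    have : z = y := by
      rw [Submodule.mem_bot, vsub_eq_sub, sub_eq_zero] at hz
      exact hz
    rw [this]
    exact hy
  · rintro c ⟨A, hyA, hAY, hdim⟩
    have h := finrank_direction_add_card_le blk A y hyA J (fun j hj z hz => hJ j hj z (hAY z hz))
    omega

/-- The block sizes sum to the total dimension. -/
theorem sum_bsize_eq (blk : Fin M → Fin n) : ∑ j : Fin n, bsize blk j = M := by
  unfold bsize
  rw [← Finset.card_eq_sum_card_fiberwise (s := (univ : Finset (Fin M))) (t := univ) (f := blk)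
    (fun i _ => Finset.mem_univ _)]
  simp

/-- An empty block vanishes at every point: `Z_j(Y) = |Y|`. -/
theorem zcount_of_bsize_eq_zero (blk : Fin M → Fin n) (Y : Finset (Fin M → ZMod 2)) (j : Fin n)
    (hj : bsize blk j = 0) : zcount blk j Y = Y.card := by
  unfold zcount
  congr 1
  apply Finset.filter_true_of_mem
  intro y _ i hi
  unfold bsize at hj
  have : i ∈ (univ.filter fun i => blk i = j) := by simp [hi]
  rw [Finset.card_eq_zero.mp hj] at this
  exact absurd this (Finset.notMem_empty i)

end Summit.PneNP.PneNP.Theorems.ClusCoordZeroFree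

namespace Summit.PneNP.PneNP.Theorems.ClusCoord

open Finset
open Summit.PneNP.PneNP.Theorems.ClusCoordZeroFree

/-- **The ZERO-FREE BASE of the peel induction** (support theorem for stmt-PneNP-19683, path `coord`): if no point of `Y` has a
vanishing NONEMPTY block, then `UCMix M n blk Y` — every point has certificate codimension `≥ #nonempty blocks` (flat lemma), so the
left-hand side is at most `e·|Y|` (`e` = number of empty blocks), which the empty blocks alone contribute on the right. -/
theorem ucMix_of_zeroFree : ∀ M n : ℕ, ∀ blk : Fin M → Fin n, ∀ Y : Finset (Fin M → ZMod 2),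
    (∀ j : Fin n, 0 < bsize blk j → zcount blk j Y = 0) → UCMix M n blk Y := by
  intro M n blk Y hZ
  unfold UCMix
  -- the nonempty blocks
  set J : Finset (Fin n) := univ.filter fun j => 0 < bsize blk j with hJ
  have hJmem : ∀ j, j ∈ J ↔ 0 < bsize blk j := fun j => by simp [hJ]
  -- no point of `Y` has a vanishing nonempty block
  have hfree : ∀ j ∈ J, ∀ z ∈ Y, ¬ (∀ i, blk i = j → z i = 0) := by
    intro j hj z hz hzero
    have h0 := hZ j ((hJmem j).1 hj)
    unfold zcount at h0
    rw [Finset.card_eq_zero, Finset.filter_eq_empty_iff] at h0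
    exact h0 hz hzero
  -- left-hand side: each summand is at most `n − |J|`
  have hsumb : ∑ j : Fin n, ((bsize blk j : ℤ) - 1) = (M : ℤ) - n := by
    rw [Finset.sum_sub_distrib, Finset.sum_const, Finset.card_univ, Fintype.card_fin, nsmul_eq_mul, mul_one]
    have := sum_bsize_eq blk
    have h' : ∑ j : Fin n, (bsize blk j : ℤ) = (M : ℤ) := by exact_mod_cast this
    rw [h']
  have hlhs : ∀ y ∈ Y, ((M : ℤ) - (acodim M Y y : ℤ)) - ∑ j : Fin n, ((bsize blk j : ℤ) - 1) ≤ (n : ℤ) - (J.card : ℤ) := by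
    intro y hy
    rw [hsumb]
    have := card_le_acodim blk Y J hfree y hy
    have h' : (J.card : ℤ) ≤ (acodim M Y y : ℤ) := by exact_mod_cast this
    linarith
  -- right-hand side: every empty block contributes `|Y|`, every other block contributes `≥ 0`
  have hrhs : ∀ j : Fin n, (if 0 < bsize blk j then (0 : ℤ) else (Y.card : ℤ)) ≤
      (2 : ℤ) ^ (bsize blk j) * (zcount blk j Y : ℤ) := by
    intro j
    split_ifs with hj
    · positivity
    · have h0 : bsize blk j = 0 := Nat.eq_zero_of_not_pos hj
      rw [h0, zcount_of_bsize_eq_zero blk Y j h0, pow_zero, one_mul]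
  have hcount : ∑ j : Fin n, (if 0 < bsize blk j then (0 : ℤ) else (Y.card : ℤ)) = ((n : ℤ) - (J.card : ℤ)) * (Y.card : ℤ) := by
    rw [Finset.sum_ite, Finset.sum_const_zero, zero_add, Finset.sum_const, nsmul_eq_mul]
    congr 1
    have h := Finset.card_filter_add_card_filter_not (s := (univ : Finset (Fin n))) (fun j => 0 < bsize blk j)
    rw [Finset.card_univ, Fintype.card_fin] at h
    rw [hJ]
    have h' : (((univ : Finset (Fin n)).filter fun j => ¬ 0 < bsize blk j).card : ℤ) =
        (n : ℤ) - (((univ : Finset (Fin n)).filter fun j => 0 < bsize blk j).card : ℤ) := by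
      have : (((univ.filter fun j => 0 < bsize blk j).card + (univ.filter fun j => ¬ 0 < bsize blk j).card : ℕ) : ℤ) = (n : ℤ) := by
        exact_mod_cast h
      push_cast at this
      linarith
    exact h'
  calc ∑ y ∈ Y, (((M : ℤ) - (acodim M Y y : ℤ)) - ∑ j : Fin n, ((bsize blk j : ℤ) - 1))
      ≤ ∑ y ∈ Y, ((n : ℤ) - (J.card : ℤ)) := Finset.sum_le_sum hlhs
    _ = ((n : ℤ) - (J.card : ℤ)) * (Y.card : ℤ) := by rw [Finset.sum_const, nsmul_eq_mul, mul_comm]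
    _ = ∑ j : Fin n, (if 0 < bsize blk j then (0 : ℤ) else (Y.card : ℤ)) := hcount.symm
    _ ≤ ∑ j : Fin n, (2 : ℤ) ^ (bsize blk j) * (zcount blk j Y : ℤ) := Finset.sum_le_sum fun j _ => hrhs j

end Summit.PneNP.PneNP.Theorems.ClusCoord
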